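import Literature.MathematicalPhysics.QuantumFieldTheory.Balaban1983to89.Node00.TorusCoverLandau153RE

/-!
# NODE 00 — THE (152)+(153) DOOR OF [Balaban1985Variational] RE-READ ON THE BOX WINDOW `π(□)`, `□ = box L c.a c.M c.k` (the whole top cube of the
# [Balaban1985RegularSpaces]-Prop.-6 datum, not only a grid cube inside it): the gauge `u`, the potential `A`, the five (152) clauses on `π(□)` AND, for the SAME `A`,
# (153) `R ∂*a = 0` in lit-balaban's V1 letters `RE (cubeDomains …) η⁻¹ (dsE η⁻¹ a) = 0` — generic datum, and the instance at the print datum `propCubeP`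

Cell `pub-ymgap`, width seat `pub-ymgap-dag-n07-w3` generation 3, CLAIM-1 ∕ INTENT-1 (cell INBOX 2026-08-28; trigger t3 of generation 2's HANDOFF: the S6 consumer
`pub-ymgap-dag-n07-w4` asked «say if your (152)∕(153) door should rather be re-read on `π '' box(propCubeP)`» — its per-plaquette ∕ per-bond tokens place every stencil in
the image of a datum BOX, where `plaqInside` ∕ `bondsDeep` hold, not in a grid cube).  EDITION v1.1 (generation 6, 2026-08-28; referee `pub-ymgap-dag-ref-L` READ-293 NITs):
the two stray build-time `#print axioms` commands at the end of the file removed and the ledger-facing sentences of this header updated (key ∕ count wording only) — all seven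
declarations and their docstrings byte-identical.  NEW leaf, PROOF kind (no `def`, no `instance`, no `notation`).  CONSUMED BY NAME,
nothing modified: generation 2's `Node00.TorusCoverLandau153TwoWindow` (`exists_localGauge152_153_window₂_of_gaugedBoundB8`), `…TestForm` (`box_subset_sq_zero`),
`…CubeDomains` (`mem_sq_zero_of_near_sq_one`, `sum_laplace_mul_diverg_re∕im_eq_zero_of_cubeDomains`), `…RE` (`RE_dsE_re∕im_eq_zero_of_cubeDomains`); generation 0's
`…Print` road for [6] Prop. 6 on print's class (`prop6Printed_zdCubP_iff`, `inAk_zdLift_of_top`, `tol_of_level_pred`, `isPrint_propCubeP`); dag-n07-e's `propCubeP` ∕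
`cubeIdxP'` (36a `Node00.TorusCoverCubeMemberPrint`) and `cubeDomains` (39 `Node00.TorusCoverCubeDomains`); N05's `CubeB8` ∕ `GaugedBoundB8` ∕ `B8Eq131Cubes.box_subset_cube`;
FILES 25 ∕ 28b (`zdLift`, `cover_add_e`, `cover_sub_e`); lit-balaban p21's `B6SectAOperatorsV1` (`RE`, `dsE`); r15's `cover`.
Filed `--kind proof --supports stmt-QuantumFields-20542` (K1⁷ — set `aside` by route `BalabanUVNodes` rev 27, whose K1-face item is K1⁸ `stmt-QuantumFields-26907`; the file is a
count-neutral helper under either key).  [15] = [Balaban1985Variational]; [6] = [Balaban1985RegularSpaces]; [B6] = [Balaban1984PropagatorsII].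

WHY.  Generation 2's capstone `exists_localGauge152_RE153_cubeDomains_of_gaugedBoundB8` extracts the (152) letters on a grid cube `cubeEnl P S a 0 ⊆ π(□)`; the grid cubes
partition the torus, so their windows miss the face-straddling plaquettes and the near-face bond stencils (dag-n07-w4's LOCATED-COVER-1), whereas the datum box `□` of [6]
p. 98 ∕ [15] (144) carries the gauge on all of `□` and — at the print datum of a grid cube — contains every stencil based in that grid cube (`Node00.TorusCoverBoxStencils`).
The two-window push-down of generation 2 is window-generic: at `X := □`, `X′ := □₀` the only window facts needed are that unit steps seen on the torus lift into `□`; since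
`□ ⊆ □₁` lies two steps inside `□₀` (collar `ρ = R₁M₁ ≥ L ≥ 2`), these follow from the ONE non-wrapping hypothesis the (153) chain already displays, `Set.InjOn (cover P) □₀` —
no separate width binder.

CONTENTS.  §1 the two step-closure facts of `□` under the cover from `Set.InjOn (cover P) (c.sq 0)`; §2 ★★ `exists_localGauge152_153_box_of_gaugedBoundB8` (six clauses, window
`π(□)`, identification `A ⟨π x, μ⟩ = A′ x μ` on ALL of `□₀`), ★★★ `exists_localGauge152_RE153_box_of_gaugedBoundB8` (five clauses + `R ∂*a = 0` in p21's letters for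
`a = Re ∕ Im(φ∘A)`), ★ `exists_localGauge152_153InGauge_box_of_gaugedBoundB8` (five clauses + the (153) test form for every `μ ∈ N(Q′_{cubeDomains c})`); §3 the instances at
the print datum `c := propCubeP P n hn M ρ hρ a` — ★★★ `…_coverBox_propCubeP_of_gaugedBoundB8` (hypothesis `GaugedBoundB8` at the datum) and ★★ `…_coverBox_propCubeP_of_prop6P`
([6] Prop. 6 ON PRINT'S CLASS at the member + the (1.7)∕(1.9)-Top class of `U`, generation 0's derivation of the datum hypothesis verbatim).

HONEST FRAMING: count-neutral kernel-lane compositions by name (two ten-line lattice lemmas + instantiations); [6] Proposition 6 at the member ∕ on print's class is a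
HYPOTHESIS (`hG` ∕ `hP6`) throughout — never asserted here; the non-wrapping of `□₀` (`Set.InjOn (cover P) (c.sq 0)`) and the `2π`-window are DISPLAYED; nothing of
[15] ∕ [6] ∕ [B6] analysis asserted; tokens NOT discharged; N07 ∕ N05 ∕ K0⁷ ∕ K1⁷ ∕ K1⁸ NOT closed or discharged; the cell's typed ∕ discharged counts are not moved by this
file (the chair's tally of record is the only count); one finite 𝕋⁴
programme at fixed ε — R4 closes the conditional finite-𝕋⁴ rung `BalabanLadder.UV` only; the YM mass gap (Clay) is NOT proved by any of this; nothing continuum ∕ ℝ⁴ ∕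
infinite volume ∕ OS.  No `sorry`, no `def`, no `instance`, no `notation`.
-/

noncomputable section

namespace Literature.MathematicalPhysics.QuantumFieldTheory.Balaban1983to89.Node00

open scoped Matrix.Norms.L2Operator InnerProductSpace RealInnerProductSpace
open B7Prop1Explicit (e e_apply)
open B7Prop1Local (InBox)
open B7Prop2Explicit (unitaryUnits)
open B8Ineq132 (InAk)
open B8Eq131Cubes (box cube bLo bHi)
open B8Eq138LandauZd (IsLandau138)
open B15Eq112TorusCover (cover)
open B14DomainGeom (Pt)
open B12RegularSpaces111 (gaugeU expI grad)
open LatticeFieldCalculus (laplace diverg)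
open B6SectAOperatorsV1 (RE dsE)
open BalabanImbrieJaffe1984to88.BIJ85AxialPropagator411 (BondSpace)
open B8LeafModelZd (ZdIdx)

variable {P : Params} {N : ℕ}

/-! ## §1  Unit steps seen on the torus lift into `□`, from the non-wrapping of `□₀` alone -/

section Steps

/-- **FORWARD UNIT STEPS SEEN ON THE TORUS LIFT INTO THE DATUM BOX `□`**, from the non-wrapping of the collared cube `□₀` alone: if `x ∈ □ = box L c.a c.M c.k` and
`π x + e_μ ∈ π(□)`, then `x + e_μ ∈ □` — both `x + e_μ` (one step off `□ ⊆ □₁`, hence in `□₀` by the collar `ρ ≥ L ≥ 2`) and the witness in `□ ⊆ □₀` lie in `□₀`, where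
`π` is injective.  (dag-n07-w4's `Sect2.add_e_mem_box_of_shift_mem_image` has the same conclusion under the width binder `Lᵏ·c.M < 2L^{m+K}`.)
[cite: Balaban1985RegularSpaces, p.98 («a distance between boundaries of these cubes is equal to R₁M₁Lʲη»), (1.131) p.99; Balaban1987RG1, (0.1) p.251] -/
theorem add_e_mem_box_of_shift_mem_image_of_injOn {K' : ℕ} {Ω' : ℕ → Set (B7Prop1Explicit.Site P.d)} (c : CubeB8 P.d P.L K' Ω')
    (hinj : Set.InjOn (cover P) (c.sq 0)) {x : Pt P.d} (hx : x ∈ box P.L c.a c.M c.k) {μ : Fin P.d}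
    (h : (cover P x).shift μ ∈ cover P '' box P.L c.a c.M c.k) : x + e μ ∈ box P.L c.a c.M c.k := by
  obtain ⟨x', hx', hc⟩ := h
  rw [← cover_add_e] at hc
  have h1 : x ∈ cube P.L c.a c.M c.ρ c.k 1 := B8Eq131Cubes.box_subset_cube c.one_le_k hx
  have h2 : x + e μ ∈ c.sq 0 :=
    mem_sq_zero_of_near_sq_one c h1 fun i => by
      rw [Pi.add_apply, add_sub_cancel_left, e_apply]
      split_ifs <;> norm_num
  rw [← hinj (box_subset_sq_zero c hx') h2 hc]
  exact hx'

/-- **BACKWARD UNIT STEPS SEEN ON THE TORUS LIFT INTO `□`**, from the non-wrapping of `□₀` alone: `x ∈ □`, `π x − e_ν ∈ π(□)` ⇒ `x − e_ν ∈ □`.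
[cite: Balaban1985RegularSpaces, p.98, (1.131) p.99; Balaban1987RG1, (0.1) p.251] -/
theorem sub_e_mem_box_of_unshift_mem_image_of_injOn {K' : ℕ} {Ω' : ℕ → Set (B7Prop1Explicit.Site P.d)} (c : CubeB8 P.d P.L K' Ω')
    (hinj : Set.InjOn (cover P) (c.sq 0)) {x : Pt P.d} (hx : x ∈ box P.L c.a c.M c.k) {ν : Fin P.d}
    (h : (cover P x).unshift ν ∈ cover P '' box P.L c.a c.M c.k) : x - e ν ∈ box P.L c.a c.M c.k := by
  obtain ⟨x', hx', hc⟩ := h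
  rw [← cover_sub_e] at hc
  have h1 : x ∈ cube P.L c.a c.M c.ρ c.k 1 := B8Eq131Cubes.box_subset_cube c.one_le_k hx
  have h2 : x - e ν ∈ c.sq 0 :=
    mem_sq_zero_of_near_sq_one c h1 fun i => by
      rw [Pi.sub_apply, sub_sub_cancel_left, abs_neg, e_apply]
      split_ifs <;> norm_num
  rw [← hinj (box_subset_sq_zero c hx') h2 hc]
  exact hx'

end Steps

/-! ## §2  ★★★ The door on the box window, generic `CubeB8` datum -/

section Box

variable [NeZero N]

/-- ★★ **THE SIX CLAUSES OF [15] (152)–(153) ON THE BOX WINDOW `π(□)`** — generation 2's two-window push-down `exists_localGauge152_153_window₂_of_gaugedBoundB8` at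
`X := □ = box L c.a c.M c.k`, `X′ := □₀ = c.sq 0` (`hbox := subset_rfl`; the step-closure of `□` from §1).  Hypotheses: `d ≥ 2`; a `CubeB8` datum `c` with `c.k = n`
whose collared cube `□₀` does not wrap (`Set.InjOn (cover P) (c.sq 0)`); `0 ≤ r` and `GaugedBoundB8 L η_n (zdLift N U) c r` ([6] (1.135)–(1.138) with the number `r` —
Prop. 6's conclusion at the member, the HYPOTHESIS); the `2π`-window.  Conclusions: `∃ u A` with the gauge equation `U^u = e^{iη_nA}` and `‖A‖ ≤ 2r` on the bonds of
`Sect2.regionOfSet P (π(□))`, `‖∇^{η_n}A‖ ≤ 2r` on its derivative quadruples, `‖∂^{η_n*}∂^{η_n}A‖ ≤ 2r` and the Laplacian member `‖Δ^{η_n}A‖ ≤ 2r` on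
`Sect2.bondsDeep (π(□))`, and a `ℤᵈ` lift `A′` with `A ⟨π x, μ⟩ = A′ x μ` on ALL of `□₀` in the (153)-gauge `IsLandau138 L c.k η_n □₀ c.lamS 1 A′`.
[cite: Balaban1985Variational, (144)–(153) pp.300–301; Balaban1985RegularSpaces, Prop. 6 (1.135)–(1.138) p.99, p.98, (1.38) p.82; Balaban1987RG1, (0.1) p.251] -/
theorem exists_localGauge152_153_box_of_gaugedBoundB8 (hd : 2 ≤ P.d) {K' : ℕ} {Ω' : ℕ → Set (B7Prop1Explicit.Site P.d)} (c : CubeB8 P.d P.L K' Ω')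
    (U : GaugeField P 0 (SU N)) {n : ℕ} (hk : c.k = n) (hinj : Set.InjOn (cover P) (c.sq 0)) {r : ℝ} (hr : 0 ≤ r)
    (hG : letI : CStarAlgebra (MatA N) := {}; GaugedBoundB8 P.L (P.eta n) (zdLift N U) c r)
    (h2π : (2 * boxWidth (bLo P.L c.a c.k 0) (bHi P.L c.a c.M c.k 0) + 1) * (P.eta n * N * (r * ((P.L : ℝ) ^ c.k * P.eta n)⁻¹)) < 2 * Real.pi) :
    ∃ u : GaugeTransf P 0 (SU N), ∃ A : PBond P 0 → MatA N,
      (∀ b ∈ (Sect2.regionOfSet P (cover P '' box P.L c.a c.M c.k)).bonds, gaugeU (fun x => ιSU N (u x)) (fun b' => ιSU N (U b')) b = expI (P.eta n) (A b)) ∧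
      (∀ b ∈ (Sect2.regionOfSet P (cover P '' box P.L c.a c.M c.k)).bonds, ‖A b‖ ≤ 2 * r) ∧
      (∀ q ∈ (Sect2.regionOfSet P (cover P '' box P.L c.a c.M c.k)).dpairs, ‖grad (P.eta n) q.2.1 (fun y => A ⟨y, q.2.2⟩) q.1‖ ≤ 2 * r) ∧
      (∀ b ∈ Sect2.bondsDeep (cover P '' box P.L c.a c.M c.k), ‖Sect2.codiffCurlA (P.eta n) A b.src b.dir‖ ≤ 2 * r) ∧
      (∀ b ∈ Sect2.bondsDeep (cover P '' box P.L c.a c.M c.k),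
          ‖∑ ν : Fin P.d, ((P.eta n : ℝ) : ℂ)⁻¹ •
              (grad (P.eta n) ν (fun y => A ⟨y, b.dir⟩) (b.src.unshift ν) - grad (P.eta n) ν (fun y => A ⟨y, b.dir⟩) b.src)‖ ≤ 2 * r) ∧
      ∃ A' : B7Prop1Explicit.Site P.d → Fin P.d → MatA N,
        (∀ x, x ∈ c.sq 0 → ∀ μ, A ⟨cover P x, μ⟩ = A' x μ) ∧
        IsLandau138 P.L c.k (P.eta n) (c.sq 0) c.lamS (1 : B7Prop1Explicit.Site P.d → Fin P.d → (MatA N)ˣ) A' :=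
  exists_localGauge152_153_window₂_of_gaugedBoundB8 hd c U hk hr hG (box_subset_sq_zero c) hinj
    (fun _ hx _ h => add_e_mem_box_of_shift_mem_image_of_injOn c hinj hx h)
    (fun _ hx _ h => sub_e_mem_box_of_unshift_mem_image_of_injOn c hinj hx h) subset_rfl h2π

/-- ★★★ **[6] PROPOSITION 6 AT NODE 00's `ℤᵈ` MEMBER ⟹ THE LOCAL GAUGE OF [15] (152) ON THE BOX WINDOW `π(□)` WITH ITS FOUR LETTERS, AND (153) `R ∂*a = 0` IN lit-balaban's
V1 LETTERS FOR EVERY REAL COMPONENT `a = Re ∕ Im(φ ∘ A)` OF THE SAME POTENTIAL** — generation 2's `exists_localGauge152_RE153_cubeDomains_of_gaugedBoundB8` with the grid-cube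
window `cubeEnl P S a 0` replaced by `π(□) = cover P '' box L c.a c.M c.k` and its binders `hSN`, `hbox` gone (hypotheses: `d ≥ 2`; `CubeB8` datum `c`, `c.k = n ≤ m + K`,
`Set.InjOn (cover P) (c.sq 0)`; `0 ≤ r`, `GaugedBoundB8 L η_n (zdLift N U) c r` (the HYPOTHESIS); the `2π`-window).  The last conjunct is [B6] (2.12)'s orthogonal projection
onto `ΔN(Q′)` of the datum's own torus tower `cubeDomains` (dag-n07-e 39) applied to `∂*a`: `RE (cubeDomains …) η_n⁻¹ (dsE η_n⁻¹ a) = 0`.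
[cite: Balaban1985Variational, (144)–(153) pp.300–301, Thm 1 (9)–(10) p.279; Balaban1985RegularSpaces, Prop. 6 (1.135)–(1.138) p.99, (1.38) p.82, (1.131) p.99; Balaban1984PropagatorsII, (2.7) p.224, (2.10)–(2.12) p.225; Balaban1987RG1, (0.1) p.251] -/
theorem exists_localGauge152_RE153_box_of_gaugedBoundB8 (hd : 2 ≤ P.d) {K' : ℕ} {Ω' : ℕ → Set (B7Prop1Explicit.Site P.d)} (c : CubeB8 P.d P.L K' Ω')
    (U : GaugeField P 0 (SU N)) {n : ℕ} (hk : c.k = n) (hn : n ≤ P.m + P.K) (hinj : Set.InjOn (cover P) (c.sq 0)) {r : ℝ} (hr : 0 ≤ r)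
    (hG : letI : CStarAlgebra (MatA N) := {}; GaugedBoundB8 P.L (P.eta n) (zdLift N U) c r)
    (h2π : (2 * boxWidth (bLo P.L c.a c.k 0) (bHi P.L c.a c.M c.k 0) + 1) * (P.eta n * N * (r * ((P.L : ℝ) ^ c.k * P.eta n)⁻¹)) < 2 * Real.pi) :
    ∃ u : GaugeTransf P 0 (SU N), ∃ A : PBond P 0 → MatA N,
      (∀ b ∈ (Sect2.regionOfSet P (cover P '' box P.L c.a c.M c.k)).bonds, gaugeU (fun x => ιSU N (u x)) (fun b' => ιSU N (U b')) b = expI (P.eta n) (A b)) ∧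
      (∀ b ∈ (Sect2.regionOfSet P (cover P '' box P.L c.a c.M c.k)).bonds, ‖A b‖ ≤ 2 * r) ∧
      (∀ q ∈ (Sect2.regionOfSet P (cover P '' box P.L c.a c.M c.k)).dpairs, ‖grad (P.eta n) q.2.1 (fun y => A ⟨y, q.2.2⟩) q.1‖ ≤ 2 * r) ∧
      (∀ b ∈ Sect2.bondsDeep (cover P '' box P.L c.a c.M c.k), ‖Sect2.codiffCurlA (P.eta n) A b.src b.dir‖ ≤ 2 * r) ∧
      (∀ b ∈ Sect2.bondsDeep (cover P '' box P.L c.a c.M c.k),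
          ‖∑ ν : Fin P.d, ((P.eta n : ℝ) : ℂ)⁻¹ •
              (grad (P.eta n) ν (fun y => A ⟨y, b.dir⟩) (b.src.unshift ν) - grad (P.eta n) ν (fun y => A ⟨y, b.dir⟩) b.src)‖ ≤ 2 * r) ∧
      (∀ φ : MatA N →L[ℂ] ℂ,
          RE (cubeDomains P c.a c.M c.ρ c.k (hk ▸ hn)) (P.eta n)⁻¹ (dsE (P.eta n)⁻¹ (WithLp.toLp 2 fun b => (φ (A b)).re : BondSpace P)) = 0 ∧
          RE (cubeDomains P c.a c.M c.ρ c.k (hk ▸ hn)) (P.eta n)⁻¹ (dsE (P.eta n)⁻¹ (WithLp.toLp 2 fun b => (φ (A b)).im : BondSpace P)) = 0) := by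
  obtain ⟨u, A, h1, h2, h3, h4, h5, h6⟩ := exists_localGauge152_153_box_of_gaugedBoundB8 hd c U hk hinj hr hG h2π
  exact ⟨u, A, h1, h2, h3, h4, h5, fun φ =>
    ⟨RE_dsE_re_eq_zero_of_cubeDomains c (hk ▸ hn) hinj h6 φ, RE_dsE_im_eq_zero_of_cubeDomains c (hk ▸ hn) hinj h6 φ⟩⟩

/-- ★ **THE SAME WITH (153) IN TEST-FUNCTION FORM** ([B6] (2.12) «⟨Δμ, ∂*a⟩ = 0 for all μ ∈ N(Q′)»): the five clauses on `π(□)` and, for every `μ` with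
`(cubeDomains P c.a c.M c.ρ c.k _).InGauge μ` and every `φ : M_N(ℂ) →L[ℂ] ℂ`, `Σ_y (laplace η_n⁻¹ μ)(y)·(diverg η_n⁻¹ (Re ∕ Im(φ∘A)))(y) = 0` — generation 2's
`exists_localGauge152_153_cubeDomains_of_gaugedBoundB8` on the box window.
[cite: Balaban1985Variational, (152)–(153) p.301; Balaban1985RegularSpaces, Prop. 6 p.99, (1.38) p.82, (1.131) p.99; Balaban1984PropagatorsII, (2.7) p.224, (2.12) p.225] -/
theorem exists_localGauge152_153InGauge_box_of_gaugedBoundB8 (hd : 2 ≤ P.d) {K' : ℕ} {Ω' : ℕ → Set (B7Prop1Explicit.Site P.d)} (c : CubeB8 P.d P.L K' Ω')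
    (U : GaugeField P 0 (SU N)) {n : ℕ} (hk : c.k = n) (hn : n ≤ P.m + P.K) (hinj : Set.InjOn (cover P) (c.sq 0)) {r : ℝ} (hr : 0 ≤ r)
    (hG : letI : CStarAlgebra (MatA N) := {}; GaugedBoundB8 P.L (P.eta n) (zdLift N U) c r)
    (h2π : (2 * boxWidth (bLo P.L c.a c.k 0) (bHi P.L c.a c.M c.k 0) + 1) * (P.eta n * N * (r * ((P.L : ℝ) ^ c.k * P.eta n)⁻¹)) < 2 * Real.pi) :
    ∃ u : GaugeTransf P 0 (SU N), ∃ A : PBond P 0 → MatA N,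
      (∀ b ∈ (Sect2.regionOfSet P (cover P '' box P.L c.a c.M c.k)).bonds, gaugeU (fun x => ιSU N (u x)) (fun b' => ιSU N (U b')) b = expI (P.eta n) (A b)) ∧
      (∀ b ∈ (Sect2.regionOfSet P (cover P '' box P.L c.a c.M c.k)).bonds, ‖A b‖ ≤ 2 * r) ∧
      (∀ q ∈ (Sect2.regionOfSet P (cover P '' box P.L c.a c.M c.k)).dpairs, ‖grad (P.eta n) q.2.1 (fun y => A ⟨y, q.2.2⟩) q.1‖ ≤ 2 * r) ∧
      (∀ b ∈ Sect2.bondsDeep (cover P '' box P.L c.a c.M c.k), ‖Sect2.codiffCurlA (P.eta n) A b.src b.dir‖ ≤ 2 * r) ∧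
      (∀ b ∈ Sect2.bondsDeep (cover P '' box P.L c.a c.M c.k),
          ‖∑ ν : Fin P.d, ((P.eta n : ℝ) : ℂ)⁻¹ •
              (grad (P.eta n) ν (fun y => A ⟨y, b.dir⟩) (b.src.unshift ν) - grad (P.eta n) ν (fun y => A ⟨y, b.dir⟩) b.src)‖ ≤ 2 * r) ∧
      (∀ μ : SiteField P 0 ℝ, (cubeDomains P c.a c.M c.ρ c.k (hk ▸ hn)).InGauge μ → ∀ φ : MatA N →L[ℂ] ℂ,
          (∑ y : Site P 0, laplace (P.eta n)⁻¹ μ y * diverg (P.eta n)⁻¹ (fun b => (φ (A b)).re) y = 0) ∧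
          (∑ y : Site P 0, laplace (P.eta n)⁻¹ μ y * diverg (P.eta n)⁻¹ (fun b => (φ (A b)).im) y = 0)) := by
  obtain ⟨u, A, h1, h2, h3, h4, h5, h6⟩ := exists_localGauge152_153_box_of_gaugedBoundB8 hd c U hk hinj hr hG h2π
  exact ⟨u, A, h1, h2, h3, h4, h5, fun μ hμ φ =>
    ⟨sum_laplace_mul_diverg_re_eq_zero_of_cubeDomains c (hk ▸ hn) hinj h6 hμ φ,
     sum_laplace_mul_diverg_im_eq_zero_of_cubeDomains c (hk ▸ hn) hinj h6 hμ φ⟩⟩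

end Box

/-! ## §3  ★★★ The instances at the print datum `propCubeP` of a grid cube -/

section PrintDatum

variable [NeZero N]

/-- ★★★ **THE DOOR AT THE PRINT DATUM `𝔔 = propCubeP P n hn M ρ hρ a` OF A GRID CUBE, FROM `GaugedBoundB8` AT THE DATUM**: window
`π(𝔔) = cover P '' box L (propCubeP …).a (propCubeP …).M n` — the set in which dag-n07-w4's `Sect2.mem_plaqInside_cover_box_propCubeP` ∕ `…mem_bondsDeep_cover_box_propCubeP`
place every plaquette ∕ bond stencil of the grid cube — with the five (152) clauses and (153) `RE (cubeDomains P (propCubeP …).a (propCubeP …).M ρ n _) η_n⁻¹ (dsE η_n⁻¹ a) = 0`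
for `a = Re ∕ Im(φ∘A)`.  The non-wrapping of the datum's collared cube is displayed as `Set.InjOn (cover P) (cube L (propCubeP …).a (propCubeP …).M (propCubeP …).ρ n 0)`
(the conclusion letter of `pub-ymgap-k0-s1-w3`'s collar numerics `injOn_cover_cube_propCubeP`, from `M + 11d + 6ρ ≤ sitesPerDir n`).
[cite: Balaban1985Variational, (144) p.300, (152)–(153) p.301; Balaban1985RegularSpaces, Prop. 6 (1.135)–(1.138) p.99, p.98, (1.38) p.82; Balaban1984PropagatorsII, (2.12) p.225; Balaban1987RG1, (0.1) p.251] -/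
theorem exists_localGauge152_RE153_coverBox_propCubeP_of_gaugedBoundB8 (hd : 2 ≤ P.d) {n : ℕ} (hn : 1 ≤ n) (hnK : n ≤ P.m + P.K)
    {M ρ : ℕ} (hρ : P.L ≤ ρ) (a : Pt P.d) (U : GaugeField P 0 (SU N))
    (hinj : Set.InjOn (cover P)
      (cube P.L (propCubeP P n hn M ρ hρ a).a (propCubeP P n hn M ρ hρ a).M (propCubeP P n hn M ρ hρ a).ρ n 0))
    {r : ℝ} (hr : 0 ≤ r)
    (hG : letI : CStarAlgebra (MatA N) := {}; GaugedBoundB8 P.L (P.eta n) (zdLift N U) (propCubeP P n hn M ρ hρ a) r)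
    (h2π : (2 * boxWidth (bLo P.L (propCubeP P n hn M ρ hρ a).a n 0) (bHi P.L (propCubeP P n hn M ρ hρ a).a (propCubeP P n hn M ρ hρ a).M n 0) + 1) *
        (P.eta n * N * (r * ((P.L : ℝ) ^ n * P.eta n)⁻¹)) < 2 * Real.pi) :
    ∃ u : GaugeTransf P 0 (SU N), ∃ A : PBond P 0 → MatA N,
      (∀ b ∈ (Sect2.regionOfSet P (cover P '' box P.L (propCubeP P n hn M ρ hρ a).a (propCubeP P n hn M ρ hρ a).M n)).bonds,
          gaugeU (fun x => ιSU N (u x)) (fun b' => ιSU N (U b')) b = expI (P.eta n) (A b)) ∧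
      (∀ b ∈ (Sect2.regionOfSet P (cover P '' box P.L (propCubeP P n hn M ρ hρ a).a (propCubeP P n hn M ρ hρ a).M n)).bonds, ‖A b‖ ≤ 2 * r) ∧
      (∀ q ∈ (Sect2.regionOfSet P (cover P '' box P.L (propCubeP P n hn M ρ hρ a).a (propCubeP P n hn M ρ hρ a).M n)).dpairs,
          ‖grad (P.eta n) q.2.1 (fun y => A ⟨y, q.2.2⟩) q.1‖ ≤ 2 * r) ∧
      (∀ b ∈ Sect2.bondsDeep (cover P '' box P.L (propCubeP P n hn M ρ hρ a).a (propCubeP P n hn M ρ hρ a).M n),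
          ‖Sect2.codiffCurlA (P.eta n) A b.src b.dir‖ ≤ 2 * r) ∧
      (∀ b ∈ Sect2.bondsDeep (cover P '' box P.L (propCubeP P n hn M ρ hρ a).a (propCubeP P n hn M ρ hρ a).M n),
          ‖∑ ν : Fin P.d, ((P.eta n : ℝ) : ℂ)⁻¹ •
              (grad (P.eta n) ν (fun y => A ⟨y, b.dir⟩) (b.src.unshift ν) - grad (P.eta n) ν (fun y => A ⟨y, b.dir⟩) b.src)‖ ≤ 2 * r) ∧
      (∀ φ : MatA N →L[ℂ] ℂ,
          RE (cubeDomains P (propCubeP P n hn M ρ hρ a).a (propCubeP P n hn M ρ hρ a).M ρ n hnK) (P.eta n)⁻¹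
              (dsE (P.eta n)⁻¹ (WithLp.toLp 2 fun b => (φ (A b)).re : BondSpace P)) = 0 ∧
          RE (cubeDomains P (propCubeP P n hn M ρ hρ a).a (propCubeP P n hn M ρ hρ a).M ρ n hnK) (P.eta n)⁻¹
              (dsE (P.eta n)⁻¹ (WithLp.toLp 2 fun b => (φ (A b)).im : BondSpace P)) = 0) :=
  exists_localGauge152_RE153_box_of_gaugedBoundB8 hd (propCubeP P n hn M ρ hρ a) U (propCubeP_k P n hn M ρ hρ a) hnK
    (by rw [CubeB8.sq_zero_eq_cube]; exact hinj) hr hG h2π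

/-- ★★ **THE DOOR AT THE PRINT DATUM FROM [6] PROPOSITION 6 ON PRINT'S CUBE CLASS AT NODE 00's `ℤᵈ` MEMBER** — generation 0's `exists_localGauge152_153_cube_of_prop6P`
(hypotheses: `d ≥ 2`; `B8.Prop6Printed d L B₁ c₁ (zdCubP (M_N ℂ) L ρ₀ ·)` — the HYPOTHESIS, [6] Prop. 6 on print's class; `ρ₀ ∣ ρ`, `L ≤ ρ`; the (1.7)∕(1.9)-Top class of
`U` at levels `≤ kT`; `1 ≤ n ≤ kT + 1`, `0 < ε_{n−1}`; the print collar `π((cubeIdxP' …).Ω 0) ⊆ Ω_{n−1}`; «7dL²M′α₀ ≤ c₁», `α₀ = L³ε_{n−1}`; the `2π`-window at the datum)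
with the grid-cube binder `hSN` replaced by the non-wrapping of the datum's collared cube and `n ≤ m + K`, ON THE BOX WINDOW, with (153) in p21's letters:
`r = 7dL²B₁M′·L³ε_{n−1}`, `M′ = sideP P M ρ`.  The derivation of `GaugedBoundB8` at the datum is generation 0's, verbatim.
[cite: Balaban1985Variational, (144)–(153) pp.300–301, Thm 1 (9)–(10) p.279; Balaban1985RegularSpaces, Prop. 6 (1.135)–(1.138) p.99, p.98, (1.7) p.77, (1.38) p.82; Balaban1984PropagatorsII, (2.12) p.225] -/
theorem exists_localGauge152_RE153_coverBox_propCubeP_of_prop6P (hd : 2 ≤ P.d) {B₁ c₁ : ℝ} (hB₁ : 0 ≤ B₁) {ρ₀ ρ : ℕ} (hρ₀ : ρ₀ ∣ ρ) (hρ : P.L ≤ ρ)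
    (hP6 : letI : CStarAlgebra (MatA N) := {}; B8.Prop6Printed P.d (P.L : ℝ) B₁ c₁ (fun i : ZdIdx P.d P.L => zdCubP (MatA N) P.L ρ₀ i))
    {Ω : ℕ → Set (Site P 0)} {Ω₀ : Set (Site P 0)} {kT : ℕ} {ε : ℕ → ℝ} (U : GaugeField P 0 (SU N))
    (hP : ∀ m, m ≤ kT → PlaqSmallOn (Sect2.omegaPlaqsTop Ω Ω₀ m) (ε m * P.eta m ^ 2) U)
    (hD : ∀ m, m ≤ kT → Sect2.CoDivSmallOn (Sect2.omegaBondsTop Ω Ω₀ m) (ε m * P.eta m ^ 3) U)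
    {n : ℕ} (hn : 1 ≤ n) (hnk : n ≤ kT + 1) (hnK : n ≤ P.m + P.K) (hε : 0 < ε (n - 1)) {M : ℕ} (a : Pt P.d)
    (hinj : Set.InjOn (cover P)
      (cube P.L (propCubeP P n hn M ρ hρ a).a (propCubeP P n hn M ρ hρ a).M (propCubeP P n hn M ρ hρ a).ρ n 0))
    (hcollar : cover P '' (cubeIdxP' P n hn M ρ a).Ω 0 ⊆ (if n - 1 = 0 then Ω₀ else Ω (n - 1)))
    (hc₁ : 7 * P.d * (P.L : ℝ) ^ 2 * (propCubeP P n hn M ρ hρ a).M * ((P.L : ℝ) ^ 3 * ε (n - 1)) ≤ c₁)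
    (h2π : (2 * boxWidth (bLo P.L (propCubeP P n hn M ρ hρ a).a n 0) (bHi P.L (propCubeP P n hn M ρ hρ a).a (propCubeP P n hn M ρ hρ a).M n 0) + 1) *
        (P.eta n * N * (7 * P.d * (P.L : ℝ) ^ 2 * B₁ * (propCubeP P n hn M ρ hρ a).M * ((P.L : ℝ) ^ 3 * ε (n - 1)) *
          ((P.L : ℝ) ^ n * P.eta n)⁻¹)) < 2 * Real.pi) :
    ∃ u : GaugeTransf P 0 (SU N), ∃ A : PBond P 0 → MatA N,
      (∀ b ∈ (Sect2.regionOfSet P (cover P '' box P.L (propCubeP P n hn M ρ hρ a).a (propCubeP P n hn M ρ hρ a).M n)).bonds,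
          gaugeU (fun x => ιSU N (u x)) (fun b' => ιSU N (U b')) b = expI (P.eta n) (A b)) ∧
      (∀ b ∈ (Sect2.regionOfSet P (cover P '' box P.L (propCubeP P n hn M ρ hρ a).a (propCubeP P n hn M ρ hρ a).M n)).bonds,
          ‖A b‖ ≤ 2 * (7 * P.d * (P.L : ℝ) ^ 2 * B₁ * (propCubeP P n hn M ρ hρ a).M * ((P.L : ℝ) ^ 3 * ε (n - 1)))) ∧
      (∀ q ∈ (Sect2.regionOfSet P (cover P '' box P.L (propCubeP P n hn M ρ hρ a).a (propCubeP P n hn M ρ hρ a).M n)).dpairs,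
          ‖grad (P.eta n) q.2.1 (fun y => A ⟨y, q.2.2⟩) q.1‖ ≤ 2 * (7 * P.d * (P.L : ℝ) ^ 2 * B₁ * (propCubeP P n hn M ρ hρ a).M * ((P.L : ℝ) ^ 3 * ε (n - 1)))) ∧
      (∀ b ∈ Sect2.bondsDeep (cover P '' box P.L (propCubeP P n hn M ρ hρ a).a (propCubeP P n hn M ρ hρ a).M n),
          ‖Sect2.codiffCurlA (P.eta n) A b.src b.dir‖ ≤ 2 * (7 * P.d * (P.L : ℝ) ^ 2 * B₁ * (propCubeP P n hn M ρ hρ a).M * ((P.L : ℝ) ^ 3 * ε (n - 1)))) ∧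
      (∀ b ∈ Sect2.bondsDeep (cover P '' box P.L (propCubeP P n hn M ρ hρ a).a (propCubeP P n hn M ρ hρ a).M n),
          ‖∑ ν : Fin P.d, ((P.eta n : ℝ) : ℂ)⁻¹ •
              (grad (P.eta n) ν (fun y => A ⟨y, b.dir⟩) (b.src.unshift ν) - grad (P.eta n) ν (fun y => A ⟨y, b.dir⟩) b.src)‖ ≤
            2 * (7 * P.d * (P.L : ℝ) ^ 2 * B₁ * (propCubeP P n hn M ρ hρ a).M * ((P.L : ℝ) ^ 3 * ε (n - 1)))) ∧
      (∀ φ : MatA N →L[ℂ] ℂ,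
          RE (cubeDomains P (propCubeP P n hn M ρ hρ a).a (propCubeP P n hn M ρ hρ a).M ρ n hnK) (P.eta n)⁻¹
              (dsE (P.eta n)⁻¹ (WithLp.toLp 2 fun b => (φ (A b)).re : BondSpace P)) = 0 ∧
          RE (cubeDomains P (propCubeP P n hn M ρ hρ a).a (propCubeP P n hn M ρ hρ a).M ρ n hnK) (P.eta n)⁻¹
              (dsE (P.eta n)⁻¹ (WithLp.toLp 2 fun b => (φ (A b)).im : BondSpace P)) = 0) := by
  letI : CStarAlgebra (MatA N) := {}
  have hηpos : 0 < P.eta n := B3GkZeroTorusRescaled.eta_pos P n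
  -- the member, the datum, the lift in the class (generation 0's derivation, verbatim)
  set i : ZdIdx P.d P.L := cubeIdxP' P n hn M ρ a with hi
  set c := propCubeP P n hn M ρ hρ a with hc
  set α : ℝ := (P.L : ℝ) ^ 3 * ε (n - 1) with hα
  have hαpos : 0 < α := mul_pos (pow_pos (by exact_mod_cast P.L_pos) 3) hε
  have hInAk : InAk P.L i.k i.η α i.Ω (zdLift N U) :=
    inAk_zdLift_of_top U hP hD hηpos (lvl := fun _ => n - 1) (fun j _ => by omega) (fun j _ => hcollar)
      (fun j hj => (tol_of_level_pred P hn hε.le hj).1) (fun j hj => (tol_of_level_pred P hn hε.le hj).2)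
  have hVU : ∀ x κ, zdLift N U x κ ∈ unitaryUnits (MatA N) := fun x κ => zdLift_mem_unitaryUnits U x κ
  -- [6] Proposition 6 ON PRINT'S CLASS at the member and the (print) datum: the HYPOTHESIS `hP6`, instantiated
  have hprint : c.IsPrint ρ₀ := (isPrint_propCubeP P n hn M ρ hρ a).of_dvd hρ₀
  have hG : GaugedBoundB8 P.L i.η (zdLift N U) c (7 * P.d * (P.L : ℝ) ^ 2 * B₁ * c.M * α) :=
    (prop6Printed_zdCubP_iff (fun i : ZdIdx P.d P.L => i) ρ₀ B₁ c₁).1 hP6 i α hαpos ⟨zdLift N U, hVU⟩ hInAk c hprint hc₁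
  have hr0 : 0 ≤ 7 * P.d * (P.L : ℝ) ^ 2 * B₁ * c.M * α := by positivity
  exact exists_localGauge152_RE153_coverBox_propCubeP_of_gaugedBoundB8 hd hn hnK hρ a U hinj hr0 hG h2π

end PrintDatum

end Literature.MathematicalPhysics.QuantumFieldTheory.Balaban1983to89.Node00

end
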